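import Mathlib.Algebra.Lie.Prod
import Literature.Algebra.Lie.LefschetzModule
import Literature.Algebra.Lie.ReductiveIdealsQuotients
import Literature.LinearAlgebra.TateResidue.FinitePotentTrace
import HarnessLib

/-!
# Direct sums of Lefschetz modules: `𝔤(𝔞′ × 𝔞″, M′ ⊞ M″) = 𝔤(𝔞′, M′) × 𝔤(𝔞″, M″)` (Looijenga–Lunts 1997, §1 p. 4)

Topic `Literature/Algebra/Lie` (namespace `Literature.Algebra.Lie`).  Lane `lit-hodgefound` (Track 2 foundations
library), skeleton seat `lit-hodgefound-skel-1` (generation 40), row **A1-99** of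
`run/shared/lean/pub/lit-hodgefound/SKELETON.md`.  Sequel of `LefschetzModule.lean` §8 (row A1-90), which proved the
Lefschetz PROPERTY of `e ⊕ e'` on `(M ⊕ N, h ⊕ h')` and left the Lie-algebra clause in its SCOPE (c).  Here: the image of
`f` on `𝔞 ⊞ 𝔟` is `{f_a ⊕ f_b}`, **`𝔤(𝔞 ⊞ 𝔟, M ⊕ N) = 𝔤(𝔞, M) × 𝔤(𝔟, N)`** (block-diagonally embedded), its
semisimplicity, and the closure of A1-88's `IsLefschetzModule` under direct sums.  THEOREMS plus two auxiliary
definitions with bodies (`prodSubmodule` = `𝔞 ⊞ 𝔟`, `prodLieHom` = the block-diagonal embedding as a morphism of Lie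
algebras); no named fact, no `sorry` (D-0026 net debt `0`).  Vocabulary: Mathlib (`LinearMap.prodMap`, the product Lie
algebra `L₁ × L₂` of `Mathlib/Algebra/Lie/Prod`, `LieHom.range`, `IsSl2Triple`, `LieAlgebra.IsSemisimple`) and the tree's
(`degreeSpace`, `IsZGrading`, `HasLefschetzProperty`, `lefschetzDomain`, `lefschetzDuals`, `lefschetzLieAlgebra`,
`IsLefschetzModule`, `hasTrivialRadical_prod`, `isSemisimple_of_surjective`, `Literature.LinearAlgebra.TateResidue.Tate.prodMap_pow`).
As in the parent file the commutator Lie ring of `𝔤𝔩(·) = Module.End K ·` is Mathlib's reducible non-instance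
`LieRing.ofAssociativeRing`, enabled FILE-LOCALLY.

## Source, VERBATIM

E. Looijenga, V. A. Lunts, *A Lie algebra attached to a projective variety*, Invent. Math. **129** (1997) 361–412
(held text `paper:arxiv-alg-geom_9604014`, page/line numbers of that text), §1, p0004 L62–L88:

> "The collection of Lefschetz modules is closed under direct sums, tensor products and taking duals. […] There is also
> an exterior direct sum and tensor product: if `(𝔞', M')` and `(𝔞'', M'')` are Lefschetz modules, then we have defined
> Lefschetz modules `(𝔞' × 𝔞'', M' ⊞ M'')`, `e_{(a',a'')}(m', m'') = (e_{a'} m', e_{a''} m'')`; `(𝔞' × 𝔞'', M' ⊠ M'')`,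
> `e_{(a',a'')}(m' ⊗ m'') = e_{a'} m' ⊗ m'' + m' ⊗ e_{a''} m''`.  The associated Lie algebra is in the first case equal
> to `𝔤(𝔞', M') × 𝔤(𝔞'', M'')`. This is also true in the second case if both factors are nonzero."

## Rendering and proof

* `M' ⊞ M''` = `M × N` with `h ⊕ h' = h.prodMap h'` (A1-90); `𝔞' × 𝔞''` acting by `e_{(a',a'')} = e_{a'} ⊕ e_{a''}` =
  `prodSubmodule K 𝔞 𝔟 = {a.prodMap b | a ∈ 𝔞, b ∈ 𝔟} ≤ 𝔤𝔩(M ⊕ N)` (the image of `𝔞 × 𝔟`, on which alone `𝔤` depends);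
  `𝔤(𝔞', M') × 𝔤(𝔞'', M'')` = the range of the block-diagonal Lie homomorphism `prodLieHom K 𝔤(𝔞, M) 𝔤(𝔟, N)` from
  Mathlib's product Lie algebra `𝔤(𝔞, M) × 𝔤(𝔟, N)` into `𝔤𝔩(M ⊕ N)`.
* Proof of "`= 𝔤(𝔞', M') × 𝔤(𝔞'', M'')`" (the source gives none): `≤` — the generators are block-diagonal, the image of `f`
  on `𝔞 ⊞ 𝔟` being `{f_a ⊕ f_b}` (`mem_lefschetzDuals_prod_iff`: a Lefschetz `a ⊕ b` has Lefschetz components,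
  `HasLefschetzProperty.fst/snd`, and `f_a ⊕ f_b` is a partner, `isSl2Triple_prodMap`, hence THE partner,
  `dualPartner_unique`); `≥` — `𝔤(𝔞, M) ⊕ 0 ≤ 𝔤(𝔞 ⊞ 𝔟, M ⊕ N)` (`prodMap_zero_mem_lefschetzLieAlgebra_prod`): for a
  generator `f_a` pick a Lefschetz `b ∈ 𝔟` (this is where "`(𝔞'', M'')` Lefschetz module" enters); then `a ⊕ 0`,
  `f_a ⊕ f_b ∈ 𝔤`, so `h ⊕ 0 = [a ⊕ 0, f_a ⊕ f_b] ∈ 𝔤` and `-2 f_a ⊕ 0 = [h ⊕ 0, f_a ⊕ f_b] ∈ 𝔤`.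
* Semisimplicity of the product (`isSemisimple_prod`: the tree's `hasTrivialRadical_prod` and Cartan's criterion), of
  `𝔤(𝔞 ⊞ 𝔟, M ⊕ N)` (`isSemisimple_lefschetzLieAlgebra_prod`, a surjective image of the product,
  `isSemisimple_of_surjective`), and **`IsLefschetzModule.prod`**.

## SCOPE (not formalised)

The tensor-product clause "This is also true in the second case if both factors are nonzero" (`𝔤(𝔞' × 𝔞'', M' ⊠ M'')`),
the dual, and Lemma (1.2) (irreducible modules with decomposable `𝔤`); injectivity of `prodLieHom` (so "`× `" is an
honest product) is `prodLieHom_injective` but no `LieEquiv` onto the range is packaged.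

## References

* [LooijengaLunts1997] E. Looijenga, V. A. Lunts, *A Lie algebra attached to a projective variety*, Invent. Math. 129
  (1997) 361–412; arXiv:alg-geom/9604014. §1 p. 4 L62–L88 (held `paper:arxiv-alg-geom_9604014` p0004).
* [Bourbaki1989LieGroups13] N. Bourbaki, *Lie Groups and Lie Algebras, Chapters 1–3*, Ch. I §6 no. 1 Remark 3 (products
  of semisimple algebras; held p0105) — via the tree's `hasTrivialRadical_prod`.
-/

noncomputable section

namespace Literature.Algebra.Lie

open Module Function Set LieModule
open LinearMap (prodMap)
open Literature.LinearAlgebra.TateResidue.Tate (prodMap_pow)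

-- The commutator Lie ring of `𝔤𝔩(·) = Module.End K ·`: Mathlib's reducible NON-instance `LieRing.ofAssociativeRing`,
-- enabled file-locally exactly as in `LefschetzModule.lean` / `Sl2PartnerUnique.lean`.
attribute [local instance 100] LieRing.ofAssociativeRing

/-! ### §1 `𝔞 ⊞ 𝔟` and the block-diagonal embedding -/

section Defs

variable (K : Type*) [CommRing K] {M N : Type*} [AddCommGroup M] [Module K M] [AddCommGroup N] [Module K N]

/-- **`𝔞 ⊞ 𝔟 := {e_a ⊕ e_b | a ∈ 𝔞, b ∈ 𝔟} ≤ 𝔤𝔩(M ⊕ N)`**, the image of `𝔞' × 𝔞''` acting on `M' ⊞ M''` by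
"`e_{(a',a'')}(m', m'') = (e_{a'} m', e_{a''} m'')`" (block-diagonal operators `LinearMap.prodMap`).
[cite: LooijengaLunts1997, §1 (1.1) p0004 L72–L79] -/
def prodSubmodule (𝔞 : Submodule K (Module.End K M)) (𝔟 : Submodule K (Module.End K N)) :
    Submodule K (Module.End K (M × N)) where
  carrier := {x | ∃ a ∈ 𝔞, ∃ b ∈ 𝔟, x = a.prodMap b}
  add_mem' := by
    rintro _ _ ⟨a, ha, b, hb, rfl⟩ ⟨a', ha', b', hb', rfl⟩
    exact ⟨a + a', 𝔞.add_mem ha ha', b + b', 𝔟.add_mem hb hb', (LinearMap.prodMap_add a a' b b').symm⟩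
  zero_mem' := ⟨0, 𝔞.zero_mem, 0, 𝔟.zero_mem, LinearMap.prodMap_zero.symm⟩
  smul_mem' := by
    rintro c _ ⟨a, ha, b, hb, rfl⟩
    exact ⟨c • a, 𝔞.smul_mem c ha, c • b, 𝔟.smul_mem c hb, (LinearMap.prodMap_smul _ c a b).symm⟩

variable {K}

/-- Membership in `𝔞 ⊞ 𝔟`. [cite: LooijengaLunts1997, §1 (1.1) p0004 L72–L79] -/
theorem mem_prodSubmodule_iff {𝔞 : Submodule K (Module.End K M)} {𝔟 : Submodule K (Module.End K N)}
    {x : Module.End K (M × N)} : x ∈ prodSubmodule K 𝔞 𝔟 ↔ ∃ a ∈ 𝔞, ∃ b ∈ 𝔟, x = a.prodMap b := Iff.rfl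

/-- `e_a ⊕ e_b ∈ 𝔞 ⊞ 𝔟`. [cite: LooijengaLunts1997, §1 (1.1) p0004 L72–L79] -/
theorem prodMap_mem_prodSubmodule {𝔞 : Submodule K (Module.End K M)} {𝔟 : Submodule K (Module.End K N)}
    {a : Module.End K M} {b : Module.End K N} (ha : a ∈ 𝔞) (hb : b ∈ 𝔟) : a.prodMap b ∈ prodSubmodule K 𝔞 𝔟 :=
  ⟨a, ha, b, hb, rfl⟩

variable (K) in
/-- **The block-diagonal embedding `𝔤 × 𝔤' → 𝔤𝔩(M ⊕ N)`, `(x, y) ↦ x ⊕ y`**, of two Lie subalgebras `𝔤 ≤ 𝔤𝔩(M)`,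
`𝔤' ≤ 𝔤𝔩(N)` — a morphism of Lie algebras from Mathlib's product Lie algebra (A1-90's `lie_prodMap`:
`[a ⊕ a', b ⊕ b'] = [a, b] ⊕ [a', b']`); its range is "`𝔤(𝔞', M') × 𝔤(𝔞'', M'')`" inside `𝔤𝔩(M' ⊞ M'')`.
[cite: LooijengaLunts1997, §1 (1.1) p0004 L86–L87 ("The associated Lie algebra is in the first case equal to 𝔤(𝔞', M') × 𝔤(𝔞'', M'')")] -/
def prodLieHom (G : LieSubalgebra K (Module.End K M)) (G' : LieSubalgebra K (Module.End K N)) :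
    G × G' →ₗ⁅K⁆ Module.End K (M × N) where
  toFun x := (x.1 : Module.End K M).prodMap (x.2 : Module.End K N)
  map_add' _ _ := rfl
  map_smul' _ _ := rfl
  map_lie' {x y} := by
    show ((⁅x.1, y.1⁆ : G) : Module.End K M).prodMap ((⁅x.2, y.2⁆ : G') : Module.End K N) = _
    rw [LieSubalgebra.coe_bracket, LieSubalgebra.coe_bracket, lie_prodMap]

/-- `prodLieHom (x, y) = x ⊕ y`. [cite: LooijengaLunts1997, §1 (1.1) p0004 L86–L87] -/
theorem prodLieHom_apply (G : LieSubalgebra K (Module.End K M)) (G' : LieSubalgebra K (Module.End K N)) (x : G × G') :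
    prodLieHom K G G' x = (x.1 : Module.End K M).prodMap (x.2 : Module.End K N) := rfl

/-- The range of the embedding is `{x ⊕ y | x ∈ 𝔤, y ∈ 𝔤'}`. [cite: LooijengaLunts1997, §1 (1.1) p0004 L86–L87] -/
theorem mem_range_prodLieHom_iff {G : LieSubalgebra K (Module.End K M)} {G' : LieSubalgebra K (Module.End K N)}
    {z : Module.End K (M × N)} : z ∈ (prodLieHom K G G').range ↔ ∃ x ∈ G, ∃ y ∈ G', z = x.prodMap y := by
  rw [LieHom.mem_range]
  constructor
  · rintro ⟨⟨x, y⟩, rfl⟩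
    exact ⟨x, x.2, y, y.2, rfl⟩
  · rintro ⟨x, hx, y, hy, rfl⟩
    exact ⟨(⟨x, hx⟩, ⟨y, hy⟩), rfl⟩

/-- `x ⊕ y` lies in the range for `x ∈ 𝔤`, `y ∈ 𝔤'`. [cite: LooijengaLunts1997, §1 (1.1) p0004 L86–L87] -/
theorem prodMap_mem_range_prodLieHom {G : LieSubalgebra K (Module.End K M)} {G' : LieSubalgebra K (Module.End K N)}
    {x : Module.End K M} {y : Module.End K N} (hx : x ∈ G) (hy : y ∈ G') :
    x.prodMap y ∈ (prodLieHom K G G').range :=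
  mem_range_prodLieHom_iff.2 ⟨x, hx, y, hy, rfl⟩

/-- The block-diagonal embedding is injective ("`×`" is an honest product). [cite: LooijengaLunts1997, §1 (1.1) p0004 L86–L87] -/
theorem prodLieHom_injective (G : LieSubalgebra K (Module.End K M)) (G' : LieSubalgebra K (Module.End K N)) :
    Function.Injective (prodLieHom K G G') := by
  rintro ⟨x, y⟩ ⟨x', y'⟩ hxy
  rw [prodLieHom_apply, prodLieHom_apply] at hxy
  have h1 : ∀ m, (x : Module.End K M) m = (x' : Module.End K M) m := fun m ↦ by
    have := LinearMap.congr_fun hxy (m, 0)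
    rw [LinearMap.prodMap_apply, LinearMap.prodMap_apply, Prod.ext_iff] at this
    exact this.1
  have h2 : ∀ n, (y : Module.End K N) n = (y' : Module.End K N) n := fun n ↦ by
    have := LinearMap.congr_fun hxy (0, n)
    rw [LinearMap.prodMap_apply, LinearMap.prodMap_apply, Prod.ext_iff] at this
    exact this.2
  exact Prod.ext (Subtype.ext (LinearMap.ext h1)) (Subtype.ext (LinearMap.ext h2))

end Defs

/-! ### §2 Components of a direct sum -/

section Components

variable {K : Type*} [Field K] {M N : Type*} [AddCommGroup M] [Module K M] [AddCommGroup N] [Module K N]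
  {h e : Module.End K M} {h' e' : Module.End K N}

/-- **The Lefschetz property of `e ⊕ e'` on `(M ⊕ N, h ⊕ h')` forces that of `e` on `(M, h)`** (the degree parts are
`M_k ⊕ N_k` and `(e ⊕ e')^k = e^k ⊕ e'^k`; converse of A1-90's `HasLefschetzProperty.prodMap`).
[cite: LooijengaLunts1997, §1 (1.1) p0004 L62, L72–L79] -/
theorem HasLefschetzProperty.fst (L : HasLefschetzProperty (h.prodMap h') (e.prodMap e')) : HasLefschetzProperty h e := by
  refine ⟨fun k x hx ↦ ?_, fun k ↦ ⟨fun x hx ↦ ?_, fun x hx y hy hxy ↦ ?_, fun y hy ↦ ?_⟩⟩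
  · have h1 := L.mapsTo k (x := (x, 0)) (mem_degreeSpace_prodMap_iff.2 ⟨hx, Submodule.zero_mem _⟩)
    rw [SetLike.mem_coe, mem_degreeSpace_prodMap_iff, LinearMap.prodMap_apply] at h1
    exact h1.1
  · have h1 := (L.bijOn k).mapsTo (x := (x, 0)) (mem_degreeSpace_prodMap_iff.2 ⟨hx, Submodule.zero_mem _⟩)
    rw [SetLike.mem_coe, mem_degreeSpace_prodMap_iff, prodMap_pow, LinearMap.prodMap_apply] at h1
    exact h1.1
  · have hx' : ((x, 0) : M × N) ∈ (degreeSpace (h.prodMap h') (-(k : ℤ)) : Set (M × N)) :=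
      mem_degreeSpace_prodMap_iff.2 ⟨hx, Submodule.zero_mem _⟩
    have hy' : ((y, 0) : M × N) ∈ (degreeSpace (h.prodMap h') (-(k : ℤ)) : Set (M × N)) :=
      mem_degreeSpace_prodMap_iff.2 ⟨hy, Submodule.zero_mem _⟩
    have h1 := (L.bijOn k).injOn hx' hy' (by
      rw [prodMap_pow, LinearMap.prodMap_apply, LinearMap.prodMap_apply, hxy])
    exact (Prod.ext_iff.1 h1).1
  · obtain ⟨⟨x, x'⟩, hx, hxy⟩ := (L.bijOn k).surjOn (mem_degreeSpace_prodMap_iff.2 ⟨hy, Submodule.zero_mem _⟩ :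
      ((y, 0) : M × N) ∈ degreeSpace (h.prodMap h') k)
    rw [prodMap_pow, LinearMap.prodMap_apply, Prod.ext_iff] at hxy
    exact ⟨x, (mem_degreeSpace_prodMap_iff.1 hx).1, hxy.1⟩

/-- … and that of `e'` on `(N, h')`. [cite: LooijengaLunts1997, §1 (1.1) p0004 L62, L72–L79] -/
theorem HasLefschetzProperty.snd (L : HasLefschetzProperty (h.prodMap h') (e.prodMap e')) : HasLefschetzProperty h' e' := by
  refine ⟨fun k x hx ↦ ?_, fun k ↦ ⟨fun x hx ↦ ?_, fun x hx y hy hxy ↦ ?_, fun y hy ↦ ?_⟩⟩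
  · have h1 := L.mapsTo k (x := (0, x)) (mem_degreeSpace_prodMap_iff.2 ⟨Submodule.zero_mem _, hx⟩)
    rw [SetLike.mem_coe, mem_degreeSpace_prodMap_iff, LinearMap.prodMap_apply] at h1
    exact h1.2
  · have h1 := (L.bijOn k).mapsTo (x := (0, x)) (mem_degreeSpace_prodMap_iff.2 ⟨Submodule.zero_mem _, hx⟩)
    rw [SetLike.mem_coe, mem_degreeSpace_prodMap_iff, prodMap_pow, LinearMap.prodMap_apply] at h1
    exact h1.2
  · have hx' : ((0, x) : M × N) ∈ (degreeSpace (h.prodMap h') (-(k : ℤ)) : Set (M × N)) :=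
      mem_degreeSpace_prodMap_iff.2 ⟨Submodule.zero_mem _, hx⟩
    have hy' : ((0, y) : M × N) ∈ (degreeSpace (h.prodMap h') (-(k : ℤ)) : Set (M × N)) :=
      mem_degreeSpace_prodMap_iff.2 ⟨Submodule.zero_mem _, hy⟩
    have h1 := (L.bijOn k).injOn hx' hy' (by
      rw [prodMap_pow, LinearMap.prodMap_apply, LinearMap.prodMap_apply, hxy])
    exact (Prod.ext_iff.1 h1).2
  · obtain ⟨⟨x', x⟩, hx, hxy⟩ := (L.bijOn k).surjOn (mem_degreeSpace_prodMap_iff.2 ⟨Submodule.zero_mem _, hy⟩ :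
      ((0, y) : M × N) ∈ degreeSpace (h.prodMap h') k)
    rw [prodMap_pow, LinearMap.prodMap_apply, Prod.ext_iff] at hxy
    exact ⟨x, (mem_degreeSpace_prodMap_iff.1 hx).2, hxy.2⟩

/-- **`𝔰𝔩₂`-triples are closed under direct sums**: `(e ⊕ e', h ⊕ h', f ⊕ f')` is an `𝔰𝔩₂`-triple of `𝔤𝔩(M ⊕ N)`
(A1-90's `lie_prodMap`). [cite: LooijengaLunts1997, §1 (1.1) p0004 L62, L72–L79] -/
theorem isSl2Triple_prodMap {f : Module.End K M} {f' : Module.End K N} (t : IsSl2Triple h e f)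
    (t' : IsSl2Triple h' e' f') : IsSl2Triple (h.prodMap h') (e.prodMap e') (f.prodMap f') where
  h_ne_zero := fun h0 ↦ t.h_ne_zero (by
    ext x
    have := LinearMap.congr_fun h0 (x, 0)
    rw [LinearMap.prodMap_apply, LinearMap.zero_apply, Prod.ext_iff] at this
    simpa using this.1)
  lie_e_f := by rw [lie_prodMap, t.lie_e_f, t'.lie_e_f]
  lie_h_e_nsmul := by
    rw [lie_prodMap, t.lie_h_e_nsmul, t'.lie_h_e_nsmul]
    refine LinearMap.ext fun z ↦ ?_
    simp only [LinearMap.prodMap_apply, LinearMap.smul_apply, Prod.smul_mk]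
  lie_h_f_nsmul := by
    rw [lie_prodMap, t.lie_h_f_nsmul, t'.lie_h_f_nsmul]
    refine LinearMap.ext fun z ↦ ?_
    simp only [LinearMap.prodMap_apply, LinearMap.neg_apply, LinearMap.smul_apply, Prod.smul_mk, Prod.neg_mk]

end Components

/-! ### §3 `𝔤(𝔞 ⊞ 𝔟, M ⊕ N) = 𝔤(𝔞, M) × 𝔤(𝔟, N)`, semisimplicity, and `IsLefschetzModule.prod` -/

section Main

variable {K : Type*} [Field K] [CharZero K] {M N : Type*} [AddCommGroup M] [Module K M] [FiniteDimensional K M]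
  [AddCommGroup N] [Module K N] [FiniteDimensional K N] {h : Module.End K M} {h' : Module.End K N}
  {𝔞 : Submodule K (Module.End K M)} {𝔟 : Submodule K (Module.End K N)}

/-- **The image of `f` on `𝔞 ⊞ 𝔟` consists of the `f_a ⊕ f_b`**: if `(a ⊕ b, h ⊕ h', f)` is an `𝔰𝔩₂`-triple of
`𝔤𝔩(M ⊕ N)` with `a ∈ 𝔞`, `b ∈ 𝔟` (both `(M, h)`, `(N, h')` `ℤ`-graded with `h, h' ≠ 0`), then `f = f_a ⊕ f_b` with
`(a, h, f_a)` and `(b, h', f_b)` `𝔰𝔩₂`-triples (a Lefschetz `a ⊕ b` has Lefschetz components, whose partners give the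
partner `f_a ⊕ f_b` of `a ⊕ b` — unique); conversely every `f_a ⊕ f_b` is in the image.
[cite: LooijengaLunts1997, §1 (1.1) p0004 L72–L87, (1.2) proof p0004 L109–L111 ("if the rational map f … is written (f', f''), then [h,f] = −2f implies …")] -/
theorem mem_lefschetzDuals_prod_iff (hgr : IsZGrading h) (hgr' : IsZGrading h') (h0 : h ≠ 0) (h0' : h' ≠ 0)
    {f : Module.End K (M × N)} :
    f ∈ lefschetzDuals K (h.prodMap h') (prodSubmodule K 𝔞 𝔟) ↔
      ∃ f₁ ∈ lefschetzDuals K h 𝔞, ∃ f₂ ∈ lefschetzDuals K h' 𝔟, f = f₁.prodMap f₂ := by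
  constructor
  · rintro ⟨x, hx, t⟩
    obtain ⟨a, ha, b, hb, rfl⟩ := mem_prodSubmodule_iff.1 hx
    have L := hasLefschetzProperty_of_isSl2Triple (isZGrading_prodMap hgr hgr') t
    have t₁ := L.fst.isSl2Triple_dual hgr h0
    have t₂ := L.snd.isSl2Triple_dual hgr' h0'
    refine ⟨_, mem_lefschetzDuals_of_isSl2Triple ha t₁ |>.2, _, mem_lefschetzDuals_of_isSl2Triple hb t₂ |>.2, ?_⟩
    exact dualPartner_unique t (isSl2Triple_prodMap t₁ t₂)
  · rintro ⟨f₁, ⟨a, ha, t₁⟩, f₂, ⟨b, hb, t₂⟩, rfl⟩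
    exact ⟨a.prodMap b, prodMap_mem_prodSubmodule ha hb, isSl2Triple_prodMap t₁ t₂⟩

/-- **`𝔤(𝔞 ⊞ 𝔟, M ⊕ N) ≤ 𝔤(𝔞, M) × 𝔤(𝔟, N)`**: the generators `e_a ⊕ e_b` and `f_a ⊕ f_b` are block-diagonal with blocks
in the two factors, and the block-diagonal operators with blocks in `𝔤(𝔞, M)`, `𝔤(𝔟, N)` form a Lie subalgebra (the range
of `prodLieHom`). [cite: LooijengaLunts1997, §1 (1.1) p0004 L86–L87] -/
theorem lefschetzLieAlgebra_prod_le (hgr : IsZGrading h) (hgr' : IsZGrading h') (h0 : h ≠ 0) (h0' : h' ≠ 0) :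
    lefschetzLieAlgebra K (h.prodMap h') (prodSubmodule K 𝔞 𝔟) ≤
      (prodLieHom K (lefschetzLieAlgebra K h 𝔞) (lefschetzLieAlgebra K h' 𝔟)).range := by
  rw [lefschetzLieAlgebra_le_iff]
  refine ⟨fun x hx ↦ ?_, fun f hf ↦ ?_⟩
  · obtain ⟨a, ha, b, hb, rfl⟩ := mem_prodSubmodule_iff.1 hx
    exact prodMap_mem_range_prodLieHom (mem_lefschetzLieAlgebra_of_mem ha) (mem_lefschetzLieAlgebra_of_mem hb)
  · obtain ⟨f₁, hf₁, f₂, hf₂, rfl⟩ := (mem_lefschetzDuals_prod_iff hgr hgr' h0 h0').1 hf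
    exact prodMap_mem_range_prodLieHom (lefschetzDuals_subset_lefschetzLieAlgebra hf₁)
      (lefschetzDuals_subset_lefschetzLieAlgebra hf₂)

omit [FiniteDimensional K M] [FiniteDimensional K N] in
/-- **`𝔤(𝔞, M) ⊕ 0 ≤ 𝔤(𝔞 ⊞ 𝔟, M ⊕ N)` as soon as `𝔟` has a Lefschetz element `b`** (with partner `f_b`): for the
generators, `e_a ⊕ 0 ∈ 𝔞 ⊞ 𝔟`, and `f_a ⊕ 0 = -½ [h ⊕ 0, f_a ⊕ f_b]` with `h ⊕ 0 = [e_a ⊕ 0, f_a ⊕ f_b]` (characteristic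
`0`); then `lieSpan_induction` (`x ↦ x ⊕ 0` is compatible with sums, scalars and brackets).
[cite: LooijengaLunts1997, §1 (1.1) p0004 L86–L87] -/
theorem prodMap_zero_mem_lefschetzLieAlgebra_prod (hne : (lefschetzDomain K h' 𝔟).Nonempty) {x : Module.End K M}
    (hx : x ∈ lefschetzLieAlgebra K h 𝔞) :
    x.prodMap (0 : Module.End K N) ∈ lefschetzLieAlgebra K (h.prodMap h') (prodSubmodule K 𝔞 𝔟) := by
  obtain ⟨b₀, hb₀, f₂, t₂⟩ := hne
  set G := lefschetzLieAlgebra K (h.prodMap h') (prodSubmodule K 𝔞 𝔟) with hG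
  rw [lefschetzLieAlgebra] at hx
  induction hx using LieSubalgebra.lieSpan_induction with
  | mem x hx =>
    rcases hx with hx | ⟨a, ha, t₁⟩
    · exact mem_lefschetzLieAlgebra_of_mem (prodMap_mem_prodSubmodule hx 𝔟.zero_mem)
    · -- `x = f_a`: `a ⊕ 0`, `f_a ⊕ f_{b₀}` ∈ G, so `h ⊕ 0` and `[h ⊕ 0, f_a ⊕ f_{b₀}] = -2 f_a ⊕ 0` ∈ G
      have h1 : a.prodMap (0 : Module.End K N) ∈ G :=
        mem_lefschetzLieAlgebra_of_mem (prodMap_mem_prodSubmodule ha 𝔟.zero_mem)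
      have h2 : x.prodMap f₂ ∈ G :=
        mem_lefschetzLieAlgebra_of_isSl2Triple (prodMap_mem_prodSubmodule ha hb₀) (isSl2Triple_prodMap t₁ t₂)
      have h3 : h.prodMap (0 : Module.End K N) ∈ G := by
        have h4 := G.lie_mem h1 h2
        rwa [lie_prodMap, t₁.lie_e_f, zero_lie] at h4
      have h5 : ((-2 : K) • x).prodMap (0 : Module.End K N) ∈ G := by
        have h6 := G.lie_mem h3 h2
        rwa [lie_prodMap, t₁.lie_lie_smul_f K, zero_lie, ← neg_smul] at h6
      have h7 := G.smul_mem (-2 : K)⁻¹ h5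
      rwa [← LinearMap.prodMap_smul, smul_zero, smul_smul, inv_mul_cancel₀ (by norm_num : (-2 : K) ≠ 0),
        one_smul] at h7
  | zero => rw [LinearMap.prodMap_zero]; exact G.zero_mem
  | add x y _ _ hx hy =>
    have h1 := G.add_mem hx hy
    rwa [← LinearMap.prodMap_add, add_zero] at h1
  | smul c x _ hx =>
    have h1 := G.smul_mem c hx
    rwa [← LinearMap.prodMap_smul, smul_zero] at h1
  | lie x y _ _ hx hy =>
    have h1 := G.lie_mem hx hy
    rwa [lie_prodMap, lie_zero] at h1

omit [FiniteDimensional K M] [FiniteDimensional K N] in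
/-- … and symmetrically **`0 ⊕ 𝔤(𝔟, N) ≤ 𝔤(𝔞 ⊞ 𝔟, M ⊕ N)`** when `𝔞` has a Lefschetz element.
[cite: LooijengaLunts1997, §1 (1.1) p0004 L86–L87] -/
theorem zero_prodMap_mem_lefschetzLieAlgebra_prod (hne : (lefschetzDomain K h 𝔞).Nonempty) {y : Module.End K N}
    (hy : y ∈ lefschetzLieAlgebra K h' 𝔟) :
    (0 : Module.End K M).prodMap y ∈ lefschetzLieAlgebra K (h.prodMap h') (prodSubmodule K 𝔞 𝔟) := by
  obtain ⟨a₀, ha₀, f₁, t₁⟩ := hne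
  set G := lefschetzLieAlgebra K (h.prodMap h') (prodSubmodule K 𝔞 𝔟) with hG
  rw [lefschetzLieAlgebra] at hy
  induction hy using LieSubalgebra.lieSpan_induction with
  | mem y hy =>
    rcases hy with hy | ⟨b, hb, t₂⟩
    · exact mem_lefschetzLieAlgebra_of_mem (prodMap_mem_prodSubmodule 𝔞.zero_mem hy)
    · have h1 : (0 : Module.End K M).prodMap b ∈ G :=
        mem_lefschetzLieAlgebra_of_mem (prodMap_mem_prodSubmodule 𝔞.zero_mem hb)
      have h2 : f₁.prodMap y ∈ G :=
        mem_lefschetzLieAlgebra_of_isSl2Triple (prodMap_mem_prodSubmodule ha₀ hb) (isSl2Triple_prodMap t₁ t₂)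
      have h3 : (0 : Module.End K M).prodMap h' ∈ G := by
        have h4 := G.lie_mem h1 h2
        rwa [lie_prodMap, t₂.lie_e_f, zero_lie] at h4
      have h5 : (0 : Module.End K M).prodMap ((-2 : K) • y) ∈ G := by
        have h6 := G.lie_mem h3 h2
        rwa [lie_prodMap, t₂.lie_lie_smul_f K, zero_lie, ← neg_smul] at h6
      have h7 := G.smul_mem (-2 : K)⁻¹ h5
      rwa [← LinearMap.prodMap_smul, smul_zero, smul_smul, inv_mul_cancel₀ (by norm_num : (-2 : K) ≠ 0),
        one_smul] at h7
  | zero => rw [LinearMap.prodMap_zero]; exact G.zero_mem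
  | add x y _ _ hx hy =>
    have h1 := G.add_mem hx hy
    rwa [← LinearMap.prodMap_add, add_zero] at h1
  | smul c x _ hx =>
    have h1 := G.smul_mem c hx
    rwa [← LinearMap.prodMap_smul, smul_zero] at h1
  | lie x y _ _ hx hy =>
    have h1 := G.lie_mem hx hy
    rwa [lie_prodMap, lie_zero] at h1

/-- **"The associated Lie algebra is in the first case equal to `𝔤(𝔞', M') × 𝔤(𝔞'', M'')`"**: for `(M, h)`, `(N, h')`
finite-dimensional `ℤ`-graded with `h, h' ≠ 0` and `𝔞`, `𝔟` both possessing a Lefschetz element,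
`𝔤(𝔞 ⊞ 𝔟, M ⊕ N) = 𝔤(𝔞, M) × 𝔤(𝔟, N)` (embedded block-diagonally, `(prodLieHom …).range`).
[cite: LooijengaLunts1997, §1 (1.1) p0004 L86–L87] -/
theorem lefschetzLieAlgebra_prod_eq (hgr : IsZGrading h) (hgr' : IsZGrading h') (h0 : h ≠ 0) (h0' : h' ≠ 0)
    (hne : (lefschetzDomain K h 𝔞).Nonempty) (hne' : (lefschetzDomain K h' 𝔟).Nonempty) :
    lefschetzLieAlgebra K (h.prodMap h') (prodSubmodule K 𝔞 𝔟) =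
      (prodLieHom K (lefschetzLieAlgebra K h 𝔞) (lefschetzLieAlgebra K h' 𝔟)).range := by
  refine le_antisymm (lefschetzLieAlgebra_prod_le hgr hgr' h0 h0') fun z hz ↦ ?_
  obtain ⟨x, hx, y, hy, rfl⟩ := mem_range_prodLieHom_iff.1 hz
  have h1 : x.prodMap y = x.prodMap 0 + (0 : Module.End K M).prodMap y := by
    rw [← LinearMap.prodMap_add, add_zero, zero_add]
  rw [h1]
  exact LieSubalgebra.add_mem _ (prodMap_zero_mem_lefschetzLieAlgebra_prod hne' hx)
    (zero_prodMap_mem_lefschetzLieAlgebra_prod hne hy)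

/-- **A product of (finite-dimensional, characteristic `0`) semisimple Lie algebras is semisimple** (the tree's
`hasTrivialRadical_prod` — Bourbaki I §6 no. 1 Remark 3 — followed by Mathlib's Cartan criterion
`HasTrivialRadical.instIsKilling`, `IsKilling.instSemisimple`). [cite: Bourbaki1989LieGroups13, Ch. I §6 no. 1 Remark 3 (p0105)] -/
theorem isSemisimple_prod {L₁ L₂ : Type*} [LieRing L₁] [LieAlgebra K L₁] [LieRing L₂] [LieAlgebra K L₂]
    [Module.Finite K L₁] [Module.Finite K L₂] [LieAlgebra.IsSemisimple K L₁] [LieAlgebra.IsSemisimple K L₂] :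
    LieAlgebra.IsSemisimple K (L₁ × L₂) := by
  haveI : LieAlgebra.HasTrivialRadical K (L₁ × L₂) := hasTrivialRadical_prod (L₂ := L₂)
  haveI := LieAlgebra.HasTrivialRadical.instIsKilling K (L₁ × L₂)
  exact LieAlgebra.IsKilling.instSemisimple K _

/-- **`𝔤(𝔞 ⊞ 𝔟, M ⊕ N)` is semisimple when `𝔤(𝔞, M)` and `𝔤(𝔟, N)` are** (a surjective image of their product,
`lefschetzLieAlgebra_prod_eq`, `isSemisimple_prod`, the tree's `isSemisimple_of_surjective`).
[cite: LooijengaLunts1997, §1 (1.1) p0004 L62–L63, L86–L87] -/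
theorem isSemisimple_lefschetzLieAlgebra_prod (hgr : IsZGrading h) (hgr' : IsZGrading h') (h0 : h ≠ 0) (h0' : h' ≠ 0)
    (hne : (lefschetzDomain K h 𝔞).Nonempty) (hne' : (lefschetzDomain K h' 𝔟).Nonempty)
    [LieAlgebra.IsSemisimple K (lefschetzLieAlgebra K h 𝔞)] [LieAlgebra.IsSemisimple K (lefschetzLieAlgebra K h' 𝔟)] :
    LieAlgebra.IsSemisimple K (lefschetzLieAlgebra K (h.prodMap h') (prodSubmodule K 𝔞 𝔟)) := by
  rw [lefschetzLieAlgebra_prod_eq hgr hgr' h0 h0' hne hne']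
  haveI := isSemisimple_prod (K := K) (L₁ := lefschetzLieAlgebra K h 𝔞) (L₂ := lefschetzLieAlgebra K h' 𝔟)
  exact isSemisimple_of_surjective (prodLieHom K (lefschetzLieAlgebra K h 𝔞) (lefschetzLieAlgebra K h' 𝔟)).rangeRestrict
    (LieHom.surjective_rangeRestrict _)

/-- **"The collection of Lefschetz modules is closed under direct sums": `(𝔞 ⊞ 𝔟, M ⊕ N)` is a Lefschetz module (A1-88's
`IsLefschetzModule`) when `(𝔞, M)` and `(𝔟, N)` are** — `ℤ`-graded (A1-90 `isZGrading_prodMap`), `𝔞 ⊞ 𝔟 ⊆ 𝔤𝔩(M ⊕ N)₂`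
abelian, with the Lefschetz element `e_a ⊕ e_b` (partner `f_a ⊕ f_b`), and `𝔤(𝔞 ⊞ 𝔟, M ⊕ N) = 𝔤(𝔞, M) × 𝔤(𝔟, N)`
semisimple. [cite: LooijengaLunts1997, §1 (1.1) p0004 L62–L63, L72–L87] -/
theorem IsLefschetzModule.prod (A : IsLefschetzModule K h 𝔞) (B : IsLefschetzModule K h' 𝔟) :
    IsLefschetzModule K (h.prodMap h') (prodSubmodule K 𝔞 𝔟) where
  isZGrading := isZGrading_prodMap A.isZGrading B.isZGrading
  le_adDegree_two := by
    rintro _ ⟨a, ha, b, hb, rfl⟩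
    rw [mem_adDegree_iff, lie_prodMap, mem_adDegree_iff.1 (A.le_adDegree_two ha), mem_adDegree_iff.1 (B.le_adDegree_two hb),
      LinearMap.prodMap_smul]
  lie_eq_zero := by
    rintro _ ⟨a, ha, b, hb, rfl⟩ _ ⟨a', ha', b', hb', rfl⟩
    rw [lie_prodMap, A.lie_eq_zero a ha a' ha', B.lie_eq_zero b hb b' hb', LinearMap.prodMap_zero]
  nonempty_lefschetzDomain := by
    obtain ⟨a, ha, f₁, t₁⟩ := A.nonempty_lefschetzDomain
    obtain ⟨b, hb, f₂, t₂⟩ := B.nonempty_lefschetzDomain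
    exact ⟨a.prodMap b, prodMap_mem_prodSubmodule ha hb, f₁.prodMap f₂, isSl2Triple_prodMap t₁ t₂⟩
  isSemisimple := by
    haveI := A.isSemisimple
    haveI := B.isSemisimple
    exact isSemisimple_lefschetzLieAlgebra_prod A.isZGrading B.isZGrading A.h_ne_zero B.h_ne_zero
      A.nonempty_lefschetzDomain B.nonempty_lefschetzDomain

end Main

end Literature.Algebra.Lie
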